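import Summits.KontsevichZagierPeriods.KontsevichZagierPeriods.Theses.ComplexOrientations
import Summits.KontsevichZagierPeriods.KontsevichZagierPeriods.Theorems.ComplexOrientationsOvalSectorDiscSector
import Summits.KontsevichZagierPeriods.KontsevichZagierPeriods.Theorems.ComplexOrientationsOvalSectorCircleInterior
import Summits.KontsevichZagierPeriods.KontsevichZagierPeriods.Theorems.ComplexOrientationsOvalSectorTranslateDisc
import Summits.KontsevichZagierPeriods.KontsevichZagierPeriods.Theorems.ComplexOrientationsOvalSectorConicSector
import Summits.KontsevichZagierPeriods.KontsevichZagierPeriods.Theorems.ComplexOrientationsOvalSectorDividingLattice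
import Literature.NumberTheory.Transcendental.KZLogCalculusProofs
import Literature.NumberTheory.Transcendental.KZSemialgebraicComplex
import Literature.NumberTheory.Transcendental.SemialgebraicMapsProofs

/-!
# `OvalSector` (crux stmt-KontsevichZagierPeriods-11369) — birth skeleton (`Lines/birth.lean`, BC3)

Route `KontsevichZagierPeriods/ComplexOrientations`, crux `OvalSector` (rank 3): Conjecture 1 of
Kontsevich–Zagier on the whole integer OVAL SECTOR of one smooth compact real affine plane curve
`{p = 0}`, `p ∈ ℚ[x,y]`: every true identity `Σ nᵢ·Area(Rᵢ) = Area(disc of radius² β)` (`nᵢ ∈ ℤ`,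
`β ≥ 0` real algebraic, `Rᵢ` the interior of the oval `Oᵢ`) is a chain of moves,
`Σ nᵢ[sᵢ] − [e] ∈ KZ.relations`.

## The cut (lead c19, after wave 1 and one reshape): six stubs landed, three open

`OvalSector_of (hT : TypeOneIdentities) : OvalSector` is the composition (no `sorry` outside the
`stub_*`). Case analysis on the data `(p, O, s, n, β, e)`:

* the ZERO identity `n = 0` — proved here (`of_mem_relations_of_integrand_one_of_value_eq_zero`:
  `Area(e) = 0`, the disc is null, `[e] ∈ relations`);
* the CIRCLE sector (every oval a circle with real-algebraic centre and radius²) — LANDED stubs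
  `stub_circleInterior` (interior = open disc), `stub_translateDisc` (one translation move),
  `stub_discSector` (dilations + rule-1b bookkeeping);
* the CONIC sector (every oval an ellipse with real-algebraic data) — LANDED stub `stub_conicSector`
  (one affine rule-2 move per ellipse onto the unit disc with a constant integrand, then rule 1b);
* `p` complex-smooth, geometrically irreducible, DIVIDING, `n = m·η` (`η` unit signs) — LANDED stub
  `stub_dividingLattice` (from the route item `TypeOneIdentities`, hypothesis BY NAME — the crux's
  declared dependency — plus `stub_discMultiple`, values read off the soundness of the calculus);
* OPEN `stub_dividingResidual` (dividing, `n ∉ ℕ·{±1}ᵏ`), OPEN `stub_nonDividing` (type II),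
  OPEN `stub_composite` (`p` not both complex-smooth and geometrically irreducible) — each is
  Conjecture 1 on its sub-sector (the VALUE side, which identities exist, is Huber–Wüstholz
  transcendence the tree cannot yet type). Moreover `stub_composite`, universally closed, is
  PROVABLY EQUIVALENT to the crux (`OvalSector_of_compositeSector` in
  `Theorems/ComplexOrientationsOvalSectorDividingLattice.lean`: `p ↦ p·(1 + x² + y²)` keeps the real
  zero set, ovals, interiors and real smoothness and kills geometric irreducibility), and every
  "reducible" sub-sector dominates the crux (adjoin a disjoint circle component), so the cut along the
  complex class of `p` is a classification, not a reduction: the lead's verdict is `promote-stub`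
  (re-line the crux by the REAL geometry of the ovals; the conic sector is the closed base case).

References: M. Kontsevich, D. Zagier, *Periods* (2001), §1.2 (rules (1), (2), Conjecture 1);
V. A. Rokhlin, *Complex orientations of real algebraic curves* (1974); A. Degtyarev, V. Kharlamov,
*Topological properties of real algebraic varieties* (2000), §1; A. Huber, G. Wüstholz,
*Transcendence and linear relations of 1-periods* (2022), Thm. 13.3; J. Bochnak, M. Coste,
M.-F. Roy, *Real Algebraic Geometry* (1998), §2.
-/

noncomputable section

open Set MeasureTheory MvPolynomial
open Literature.NumberTheory.Transcendental Literature.ModelTheory.ExponentialFields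
open Summit.KontsevichZagierPeriods.KontsevichZagierPeriods.Theses.ComplexOrientations

set_option linter.dupNamespace false

namespace Summit.KontsevichZagierPeriods.ComplexOrientations.OvalSector

/-! ### Registered stubs — LANDED (imported from `Theorems/`)

* `stub_discMultiple`, `stub_discSector` — `Theorems/ComplexOrientationsOvalSectorDiscSector.lean`
  (p146160);
* `stub_circleInterior` — `Theorems/ComplexOrientationsOvalSectorCircleInterior.lean` (p147842);
* `stub_translateDisc` — `Theorems/ComplexOrientationsOvalSectorTranslateDisc.lean` (p147865);
* `stub_conicSector` — `Theorems/ComplexOrientationsOvalSectorConicSector.lean` (p149827);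
* `stub_dividingLattice` — `Theorems/ComplexOrientationsOvalSectorDividingLattice.lean` (p150100, with the
  certificate `OvalSector_of_compositeSector` / `compositeSector_of_OvalSector`: `stub_composite` ⟺ crux).
-/

/-! ### Registered stubs — the open sub-sectors -/

/-- **Stub** `stub_dividingResidual` (the non-forced identities of a DIVIDING curve). For
`p ∈ ℚ[x,y]` with compact real zero locus, smooth and geometrically irreducible as a complex affine
curve, and dividing (its non-real affine locus is not preconnected), with ovals `Oᵢ` and interior
representations `sᵢ` as in `OvalSector`: every true identity `Σ nᵢ·Area(Rᵢ) = Area(e)` against the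
disc of radius² `β` whose coefficient vector `n ≠ 0` is NOT a non-negative integer multiple `m·η` of
a unit-sign vector `η ∈ {±1}ᵏ` is a chain of moves. For a generic dividing curve
(`End Jac = ℤ`, places at infinity in general position) there is no such identity — the
`ℚ̄`-relations among `1, π, Area(Rᵢ)` are `ℤ·(★)`, Rokhlin's complex-orientation identity, which has
unit signs (Huber–Wüstholz; card K2 `OvalRelationsTopological`) — so the content is the symmetric /
CM type-I curves, where the extra identities come from automorphisms (one rule-2 move) and
correspondences (isogeny-type chains). Size XL (Conjecture 1 on this sub-sector).
[cite: KontsevichZagier2001, §1.2 Conjecture 1] [cite: HuberWustholz2022, Thm. 13.3]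
[cite: Rokhlin1974] -/
theorem stub_dividingResidual (p : MvPolynomial (Fin 2) ℚ)
    (hZ : IsCompact {v : Fin 2 → ℝ | MvPolynomial.aeval v p = 0})
    (hcs : ∀ w : Fin 2 → ℂ, MvPolynomial.aeval w p = 0 →
      ∃ i, MvPolynomial.aeval w (MvPolynomial.pderiv i p) ≠ 0)
    (hirr : Irreducible (MvPolynomial.map (algebraMap ℚ ℂ) p))
    (hdiv : ¬ IsPreconnected {w : Fin 2 → ℂ | MvPolynomial.aeval w p = 0 ∧ ∃ i, (w i).im ≠ 0})
    (k : ℕ) (O : Fin k → Set (Fin 2 → ℝ)) (s : Fin k → KZ.IntegralRep 2)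
    (hO : ∀ i, ∃ v : Fin 2 → ℝ, MvPolynomial.aeval v p = 0 ∧
      O i = connectedComponentIn {u : Fin 2 → ℝ | MvPolynomial.aeval u p = 0} v)
    (hOinj : Function.Injective O)
    (hOcov : ∀ v : Fin 2 → ℝ, MvPolynomial.aeval v p = 0 → ∃ i, v ∈ O i)
    (hsdom : ∀ i, (s i).domain =
      {v : Fin 2 → ℝ | v ∉ O i ∧ Bornology.IsBounded (connectedComponentIn (O i)ᶜ v)})
    (hsint : ∀ i, ∀ v ∈ (s i).domain, (s i).integrand v = 1)
    (n : Fin k → ℤ) (hn : n ≠ 0)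
    (hoff : ¬ ∃ (m : ℕ) (η : Fin k → ℤ), (∀ i, η i = 1 ∨ η i = -1) ∧ ∀ i, n i = m * η i)
    (β : ℝ) (e : KZ.IntegralRep 2) (hβ : IsAlgebraic ℚ β) (hβ0 : 0 ≤ β)
    (hedom : e.domain = {v : Fin 2 → ℝ | v 0 ^ 2 + v 1 ^ 2 < β})
    (heint : ∀ v ∈ e.domain, e.integrand v = 1)
    (hval : ∑ i, (n i : ℝ) * (s i).value = e.value) :
    (∑ i, n i • KZ.of (s i)) - KZ.of e ∈ KZ.relations := by
  sorry

/-- **Stub** `stub_nonDividing` (type II curves). For `p ∈ ℚ[x,y]` with compact real zero locus,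
smooth and geometrically irreducible as a complex affine curve, whose non-real affine locus IS
preconnected (no signed combination of ovals bounds a half of the complex curve), with ovals and
interior representations as in `OvalSector`: every true identity `Σ nᵢ·Area(Rᵢ) = Area(e)`,
`n ≠ 0`, against the disc of radius² `β` is a chain of moves. Generically VACUOUS: for
`End Jac = ℤ` the numbers `1, π, Area(R₁), …, Area(R_ℓ)` of a type II curve are `ℚ̄`-linearly
independent (Huber–Wüstholz: relations among 1-periods come from cycle relations — none here, the
ovals being homologically independent modulo the places at infinity — and from correspondences);
the content is the curves with automorphisms (`Area(R) = Area(R')` for ovals swapped by a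
symmetry: one rule-2 move) or extra correspondences. Size XL (Conjecture 1 on this sub-sector).
[cite: KontsevichZagier2001, §1.2 Conjecture 1] [cite: HuberWustholz2022, Thm. 13.3]
[cite: DegtyarevKharlamov2000, §1] -/
theorem stub_nonDividing (p : MvPolynomial (Fin 2) ℚ)
    (hZ : IsCompact {v : Fin 2 → ℝ | MvPolynomial.aeval v p = 0})
    (hcs : ∀ w : Fin 2 → ℂ, MvPolynomial.aeval w p = 0 →
      ∃ i, MvPolynomial.aeval w (MvPolynomial.pderiv i p) ≠ 0)
    (hirr : Irreducible (MvPolynomial.map (algebraMap ℚ ℂ) p))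
    (hndiv : IsPreconnected {w : Fin 2 → ℂ | MvPolynomial.aeval w p = 0 ∧ ∃ i, (w i).im ≠ 0})
    (k : ℕ) (O : Fin k → Set (Fin 2 → ℝ)) (s : Fin k → KZ.IntegralRep 2)
    (hO : ∀ i, ∃ v : Fin 2 → ℝ, MvPolynomial.aeval v p = 0 ∧
      O i = connectedComponentIn {u : Fin 2 → ℝ | MvPolynomial.aeval u p = 0} v)
    (hOinj : Function.Injective O)
    (hOcov : ∀ v : Fin 2 → ℝ, MvPolynomial.aeval v p = 0 → ∃ i, v ∈ O i)
    (hsdom : ∀ i, (s i).domain =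
      {v : Fin 2 → ℝ | v ∉ O i ∧ Bornology.IsBounded (connectedComponentIn (O i)ᶜ v)})
    (hsint : ∀ i, ∀ v ∈ (s i).domain, (s i).integrand v = 1)
    (n : Fin k → ℤ) (hn : n ≠ 0)
    (β : ℝ) (e : KZ.IntegralRep 2) (hβ : IsAlgebraic ℚ β) (hβ0 : 0 ≤ β)
    (hedom : e.domain = {v : Fin 2 → ℝ | v 0 ^ 2 + v 1 ^ 2 < β})
    (heint : ∀ v ∈ e.domain, e.integrand v = 1)
    (hval : ∑ i, (n i : ℝ) * (s i).value = e.value) :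
    (∑ i, n i • KZ.of (s i)) - KZ.of e ∈ KZ.relations := by
  sorry

/-- **Stub** `stub_composite` (geometrically reducible curves and curves singular off `ℝ²`). For
`p ∈ ℚ[x,y]` with compact, real-smooth real zero locus which is NOT both smooth and geometrically
irreducible as a complex affine curve (so `p` factors over `ℚ̄`, e.g. `(x²+y²−3)² − 2`, two circles
over `ℚ(√2)`, or `(x²+y²−1)(x²+y²+1)`; or two complex branches cross at a non-real point), with
ovals and interior representations as in `OvalSector`: every true identity `Σ nᵢ·Area(Rᵢ) = Area(e)`,
`n ≠ 0`, against the disc of radius² `β` is a chain of moves. Mechanism: the ovals of `p` are the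
ovals of its real geometric components (pairwise disjoint by real smoothness), whose coefficients lie
in a real number field — the per-component engines restated over `ℚ̄ ∩ ℝ` (KZ §1.1: algebraic
coefficients are `ℚ`-definable) — plus the identities between components exchanged by a symmetry of
`p` (one rule-2 move) or related by a correspondence. Size XL (Conjecture 1 on this sub-sector).
[cite: KontsevichZagier2001, §1.1–1.2] [cite: BochnakCosteRoy1998, §2.2] -/
theorem stub_composite (p : MvPolynomial (Fin 2) ℚ)
    (hZ : IsCompact {v : Fin 2 → ℝ | MvPolynomial.aeval v p = 0})
    (hsm : ∀ v : Fin 2 → ℝ, MvPolynomial.aeval v p = 0 →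
      ∃ i, MvPolynomial.aeval v (MvPolynomial.pderiv i p) ≠ 0)
    (hcomp : ¬ ((∀ w : Fin 2 → ℂ, MvPolynomial.aeval w p = 0 →
        ∃ i, MvPolynomial.aeval w (MvPolynomial.pderiv i p) ≠ 0) ∧
      Irreducible (MvPolynomial.map (algebraMap ℚ ℂ) p)))
    (k : ℕ) (O : Fin k → Set (Fin 2 → ℝ)) (s : Fin k → KZ.IntegralRep 2)
    (hO : ∀ i, ∃ v : Fin 2 → ℝ, MvPolynomial.aeval v p = 0 ∧
      O i = connectedComponentIn {u : Fin 2 → ℝ | MvPolynomial.aeval u p = 0} v)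
    (hOinj : Function.Injective O)
    (hOcov : ∀ v : Fin 2 → ℝ, MvPolynomial.aeval v p = 0 → ∃ i, v ∈ O i)
    (hsdom : ∀ i, (s i).domain =
      {v : Fin 2 → ℝ | v ∉ O i ∧ Bornology.IsBounded (connectedComponentIn (O i)ᶜ v)})
    (hsint : ∀ i, ∀ v ∈ (s i).domain, (s i).integrand v = 1)
    (n : Fin k → ℤ) (hn : n ≠ 0)
    (β : ℝ) (e : KZ.IntegralRep 2) (hβ : IsAlgebraic ℚ β) (hβ0 : 0 ≤ β)
    (hedom : e.domain = {v : Fin 2 → ℝ | v 0 ^ 2 + v 1 ^ 2 < β})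
    (heint : ∀ v ∈ e.domain, e.integrand v = 1)
    (hval : ∑ i, (n i : ℝ) * (s i).value = e.value) :
    (∑ i, n i • KZ.of (s i)) - KZ.of e ∈ KZ.relations := by
  sorry

/-! ### Proved glue -/

/-- An integral representation whose integrand is `1` on its domain and whose value is `0` is a
relation: its domain has finite (integrability of `1`) hence zero measure, and a representation over
a null domain is a relation (rule 1). [cite: KontsevichZagier2001, §1.2 rule (1)] -/
theorem of_mem_relations_of_integrand_one_of_value_eq_zero {d : ℕ} (r : KZ.IntegralRep d)
    (h1 : ∀ v ∈ r.domain, r.integrand v = 1) (h0 : r.value = 0) :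
    KZ.of r ∈ KZ.relations := by
  have hmeas : MeasurableSet r.domain := KZ.IntegralRep.measurableSet_domain_holds r
  have hint : IntegrableOn (fun _ => (1 : ℝ)) r.domain := r.integrableOn.congr_fun h1 hmeas
  have hfin : volume r.domain < ⊤ := by
    rcases (integrableOn_const_iff (C := (1 : ℝ))).1 hint with h | h
    · simp at h
    · exact h
  have hval : r.value = (volume r.domain).toReal := by
    show ∫ x in r.domain, r.integrand x = (volume r.domain).toReal
    rw [setIntegral_congr_fun hmeas h1, setIntegral_const, smul_eq_mul, mul_one]
    rfl
  apply KZ.of_mem_relations_of_volume_eq_zero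
  have h : (volume r.domain).toReal = 0 := hval ▸ h0
  rcases ENNReal.toReal_eq_zero_iff _ |>.1 h with h' | h'
  · exact h'
  · exact absurd h' hfin.ne

/-! ### The composition -/

/-- **Composition.** `OvalSector` from the route item `TypeOneIdentities` (the crux's declared
dependency, taken by name) and the four registered stubs: the zero identity is a null disc; in the
dividing regime an identity with coefficient vector `m·η` (`η` unit signs, `m ≥ 1`) is `m` times the
unit-sign identity against the disc of radius² `β/m` (`TypeOneIdentities`) plus the disc
bookkeeping `m·[disc β/m] ~ [disc β]` (`stub_discMultiple`), the value of the unit-sign identity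
being read off the soundness of the calculus; the remaining identities are `stub_dividingResidual`,
`stub_nonDividing`, `stub_composite` according to the class of the curve.
[cite: KontsevichZagier2001, §1.2 Conjecture 1] [cite: Rokhlin1974] -/
theorem OvalSector_of (hT : TypeOneIdentities) : OvalSector := by
  intro p hZ hsm k O s hO hOinj hOcov hsdom hsint n β e hβ hβ0 hedom heint hval
  -- (0) the zero identity: `Area(e) = 0`, so the disc is null and `[e]` is a relation
  by_cases hn0 : n = 0
  · subst hn0
    have hv : e.value = 0 := by simpa using hval.symm
    have he : KZ.of e ∈ KZ.relations :=
      of_mem_relations_of_integrand_one_of_value_eq_zero e heint hv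
    simpa using KZ.relations.neg_mem he
  -- (C) the CIRCLE SECTOR: every oval is a real-algebraic circle — closed by the three circle stubs
  by_cases hcirc : ∀ i, ∃ a b c : ℝ, IsAlgebraic ℚ a ∧ IsAlgebraic ℚ b ∧ IsAlgebraic ℚ c ∧ 0 < c ∧
      O i = {u : Fin 2 → ℝ | (u 0 - a) ^ 2 + (u 1 - b) ^ 2 = c}
  · choose a b c ha hb hc hc0 hOc using hcirc
    -- the interiors are the open discs (stub_circleInterior), translated to the origin
    -- (stub_translateDisc)
    have hsd : ∀ i, (s i).domain = {v : Fin 2 → ℝ | (v 0 - a i) ^ 2 + (v 1 - b i) ^ 2 < c i} := by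
      intro i
      rw [hsdom i, hOc i, stub_circleInterior (a i) (b i) (c i) (hc0 i)]
    choose d hdd hd1 hrel using fun i =>
      stub_translateDisc (a i) (b i) (c i) (ha i) (hb i) (hc i) (s i) (hsd i) (hsint i)
    -- values agree along the translation moves (soundness)
    have hvals : ∀ i, (s i).value = (d i).value := fun i =>
      KZ.Equivalent.value_eq_holds (hrel i)
    have hval' : ∑ i, (n i : ℝ) * (d i).value = e.value := by
      rw [← hval]
      exact Finset.sum_congr rfl fun i _ => by rw [hvals i]
    -- the disc sector is a chain (stub_discSector)
    have hD : (∑ i, n i • KZ.of (d i)) - KZ.of e ∈ KZ.relations :=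
      stub_discSector k c hc (fun i => (hc0 i).le) d hdd hd1 n β e hβ hβ0 hedom heint hval'
    have hsplit : (∑ i, n i • KZ.of (s i)) - KZ.of e =
        (∑ i, n i • (KZ.of (s i) - KZ.of (d i))) + ((∑ i, n i • KZ.of (d i)) - KZ.of e) := by
      simp only [smul_sub, Finset.sum_sub_distrib]
      abel
    rw [hsplit]
    exact KZ.relations.add_mem
      (KZ.relations.sum_mem fun i _ => KZ.relations.zsmul_mem (hrel i) _) hD
  -- (E) the CONIC SECTOR: every oval is an ellipse with real-algebraic data (stub_conicSector)
  by_cases hell : ∀ i, ∃ (A B C ρ : ℝ) (c : Fin 2 → ℝ), 0 < A ∧ 0 < 4 * A * C - B ^ 2 ∧ 0 < ρ ∧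
      IsAlgebraic ℚ A ∧ IsAlgebraic ℚ B ∧ IsAlgebraic ℚ C ∧ IsAlgebraic ℚ ρ ∧
      (∀ j, IsAlgebraic ℚ (c j)) ∧
      O i = {u : Fin 2 → ℝ |
        A * (u - c) 0 ^ 2 + B * ((u - c) 0 * (u - c) 1) + C * (u - c) 1 ^ 2 = ρ}
  · choose A B C ρ c hA hD hρ hAa hBa hCa hρa hc hOe using hell
    exact stub_conicSector k O s A B C ρ c hA hD hρ hAa hBa hCa hρa hc hOe hsdom hsint n β e hβ
      hβ0 hedom heint hval
  -- (1) the class of the curve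
  by_cases hc : (∀ w : Fin 2 → ℂ, MvPolynomial.aeval w p = 0 →
      ∃ i, MvPolynomial.aeval w (MvPolynomial.pderiv i p) ≠ 0) ∧
      Irreducible (MvPolynomial.map (algebraMap ℚ ℂ) p)
  swap
  · exact stub_composite p hZ hsm hc k O s hO hOinj hOcov hsdom hsint n hn0 β e hβ hβ0 hedom
      heint hval
  obtain ⟨hcs, hirr⟩ := hc
  by_cases hpre : IsPreconnected {w : Fin 2 → ℂ | MvPolynomial.aeval w p = 0 ∧ ∃ i, (w i).im ≠ 0}
  · exact stub_nonDividing p hZ hcs hirr hpre k O s hO hOinj hOcov hsdom hsint n hn0 β e hβ hβ0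
      hedom heint hval
  -- (2) dividing curve: is `n` a non-negative multiple of a unit-sign vector?
  by_cases hlat : ∃ (m : ℕ) (η : Fin k → ℤ), (∀ i, η i = 1 ∨ η i = -1) ∧ ∀ i, n i = m * η i
  swap
  · exact stub_dividingResidual p hZ hcs hirr hpre k O s hO hOinj hOcov hsdom hsint n hn0 hlat β e
      hβ hβ0 hedom heint hval
  obtain ⟨m, η, hη, hnm⟩ := hlat
  have hn : n = fun i => (m : ℤ) * η i := funext hnm
  subst hn
  exact stub_dividingLattice hT p hZ hcs hirr hpre k O s hO hOinj hOcov hsdom hsint m η hη β e hβ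
    hβ0 hedom heint (by simpa only [Int.cast_mul, Int.cast_natCast] using hval)

end Summit.KontsevichZagierPeriods.ComplexOrientations.OvalSector

end
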